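import Summits.CriticalPhenomena.PercolationContinuityZ3.Theses.PercLoopDislocationCovers
import Summits.CriticalPhenomena.PercolationContinuityZ3.Theorems.PercNearOneGluingNoHeavyLowerTailCSHTheoremOne
import Literature.Probability.Percolation.DislocationLoopCover
import HarnessLib

/-!
# `PercLoopDislocationCovers.CoverIsCoveringR` (stmt-CriticalPhenomena-13889) — SETTLED after continuity

Item `stmt-CriticalPhenomena-13889` of route `CriticalPhenomena/PercLoopDislocationCovers` (support): for `s ≥ 2` the named cover `dislocationLoopCover s` is a covering of `ℤ³` (neighbourhoods map bijectively).

Literally the Literature theorem `DislocationLoopCover.bijOn_fst_neighborSet` (valid for every `s`).  p205010 is NOT used.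

builds on p205010 (kernel theorem, internal audit signed; external expert review pending) — USED (`CSH.percolationContinuityZ3_holds`).  RSW3 lane, lead gen 28 (prover-prim-rsw3-lead-g28-0):
'after continuity — the ledger harvest'.
References: G. Kozma, N. Nitzan (2024), Thm. 6 / Conj. 3 [KozmaNitzan2024]; G. Grimmett, *Percolation* (1999), §8 [GrimmettPercolation1999].
-/

noncomputable section

namespace Summit.CriticalPhenomena.PercolationContinuityZ3.Theorems

namespace PercLoopDislocationCoversCoverIsCoveringR

open MeasureTheory Literature.Probability.Percolation Literature.Probability.LatticeModels

/-- **`PercLoopDislocationCovers.CoverIsCoveringR` (stmt-CriticalPhenomena-13889), settled.**  `DislocationLoopCover.bijOn_fst_neighborSet s v`.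
[cite: KozmaNitzan2024, Thm. 6 with Conj. 3 (p. 15)] -/
theorem coverIsCoveringR_proof : Summit.CriticalPhenomena.PercolationContinuityZ3.Theses.PercLoopDislocationCovers.CoverIsCoveringR := by
  unfold Summit.CriticalPhenomena.PercolationContinuityZ3.Theses.PercLoopDislocationCovers.CoverIsCoveringR
  intro s _ v
  exact DislocationLoopCover.bijOn_fst_neighborSet s v

end PercLoopDislocationCoversCoverIsCoveringR

end Summit.CriticalPhenomena.PercolationContinuityZ3.Theorems

end
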